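import Mathlib
import HarnessLib
import Summits.NavierStokesRegularity.NavierStokesRegularity.Theorems.PoloidalWindowDoorLrcModEntireCurvedTimeWebFunction
import Summits.NavierStokesRegularity.NavierStokesRegularity.Theorems.PoloidalWindowDoorLrcModEntireCurvedWebPackage
import Summits.NavierStokesRegularity.NavierStokesRegularity.Theorems.PoloidalWindowDoorLrcModEntireQ4TimeWebPackage

/-!
# Route `PoloidalWindowDoor`, item `LrcModEntire` (stmt-NavierStokesRegularity-20428), cell (Q4-curved) of the (TH) column —
# B-TWP0c: THE CURVED TIME-WEB PACKAGE AT BASE TIME `0` (time-web function over the curved hot branch, identities, Fermi Huygens family, parallel webs)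

Cell ns-regularity-ideate, stub-worker seat ns-poloidal-K2-p2 g18 under the LEAD of item 20428 (ns-poloidal-K2-p3 g17/g18);
`--supports stmt-NavierStokesRegularity-20428 --as helper`.  Memo `Cruxes/LrcModEntire/TOWER-CLOSES-port2g9.md` §D1/§E, LEAD 2026-08-29T23:13:57Z (v16: split
`stub_Q4curvedAperiodic` by «critical sheet NON-VERTICAL» (closable by the tower at base time `0`) vs the vertical residue).  The curved twin of port-2 g8's
`…Q4TimeWebPackage.time_web_package_line`: from the (Q4) binders over an ARBITRARY `C^∞` unit-speed horizontal hot branch `Γ` (hypotheses of this seat's g16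
`…CurvedWebPackage.curved_web_package`, NO line literal, NO sonic literal) —

★★ `curved_time_web_package` — a window `δ′ ≤ δ, ρ`, `δ′ < 1/2`; the Frenet curvature `k` of `Γ` (differentiable, bounded) and the parallel offset `d` of
`curved_web_package` (`d 0 = 0`, `C^∞`, `|k(s)d(z)| ≤ 1/2`); the SPACE–TIME web function `n₀(τ,s,z)` in `Γ`'s Fermi frame for `|τ|,|z| < δ′` and all `s`
(`…CurvedTimeWebFunction.exists_curvedTimeWebFunction`), `C^m` jointly for every `m`; at every web point `Γ s + n₀·JΓ′ s + z·e₂`: the maximiser property, horizontal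
criticality, `κt(τ,z) > 0`, `μ(−1+τ,z) < 1`, the RIDGE LAW `B(Γ′,Γ′) + B(JΓ′,JΓ′) = −κt(τ,z)` (s-free at EVERY nearby time: `…RidgeWebLawHoriz.horizLaplacian_two_eq_of_webFermat`
+ `frame_trace_at`), the SLICE LAW, and the FERMI HUYGENS FAMILY `κt·(1 − k(s)n₀)²·(∂_z n₀)² = (R_zz − μκt)·((1 − k(s)n₀)² + (∂_s n₀)²)` (this seat's g16
`…CurvedWebHuygens.curved_huygens_identity`); and PARALLEL WEBS at `τ = 0`: `n₀(0,s,z) = d(z)` (uniqueness of the maximiser against `curved_web_package`).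
This is the `∀ σ₀`-clause currency of `…FermiTimeWebAt.curved_timeWeb_at` (case II) at base time `0` over the curved branch, minus the line-frame conjunct and the
transversal window — the latter is the v16 child literal's job (vertical/non-vertical sheet), not derivable here.

WHAT THIS IS NOT: not a claim about Navier–Stokes regularity; closes nothing; items 20428 / 19708 / 27893 OPEN (bears_on LADDER-NS N0).
-/

noncomputable section

set_option linter.dupNamespace false
set_option linter.style.longLine false

namespace Summit.NavierStokesRegularity.NavierStokesRegularity.Theorems.PoloidalWindowDoorLrcModEntireCurvedTimeWebAt

open Set Function Filter Topology Metric
open scoped RealInnerProductSpace InnerProductSpace Laplacian ContDiff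
open Literature.Analysis Literature.Analysis.FluidPDE Literature.Analysis.UnboundedOperators
open Summit.NavierStokesRegularity.NavierStokesRegularity.Theorems
open Summit.NavierStokesRegularity.NavierStokesRegularity.Theorems.LocalSineTubeDoorProfileAlignedWindowRigidityAncient
open Summit.NavierStokesRegularity.NavierStokesRegularity.Theorems.PoloidalWindowDoorLrcModEntireSheetFlattenTools
open Summit.NavierStokesRegularity.NavierStokesRegularity.Theorems.PoloidalWindowDoorLrcModEntireParallelWebsIdentity
open Summit.NavierStokesRegularity.NavierStokesRegularity.Theorems.PoloidalWindowDoorLrcModEntireRidgeGlobalBranchODE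
open Summit.NavierStokesRegularity.NavierStokesRegularity.Theorems.PoloidalWindowDoorLrcModEntireRidgeGlobalBranchFrame
open Summit.NavierStokesRegularity.NavierStokesRegularity.Theorems.PoloidalWindowDoorLrcModEntirePlanarCurveRigidity
open Summit.NavierStokesRegularity.NavierStokesRegularity.Theorems.PoloidalWindowDoorLrcModEntireQ4LineTools
open Summit.NavierStokesRegularity.NavierStokesRegularity.Theorems.PoloidalWindowDoorLrcModEntireRidgeWebLaw
open Summit.NavierStokesRegularity.NavierStokesRegularity.Theorems.PoloidalWindowDoorLrcModEntireRidgeClassConstants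
open Summit.NavierStokesRegularity.NavierStokesRegularity.Theorems.PoloidalWindowDoorLrcModEntireRidgeWebLawHoriz
open Summit.NavierStokesRegularity.NavierStokesRegularity.Theorems.PoloidalWindowDoorLrcModEntireQ4TimeWebFunction
open Summit.NavierStokesRegularity.NavierStokesRegularity.Theorems.PoloidalWindowDoorLrcModEntireCurvedWebHuygens
open Summit.NavierStokesRegularity.NavierStokesRegularity.Theorems.PoloidalWindowDoorLrcModEntireCurvedWebPackage
open Summit.NavierStokesRegularity.NavierStokesRegularity.Theorems.PoloidalWindowDoorLrcModEntireCurvedTimeWebFunction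

/-- ★★ **THE CURVED TIME-WEB PACKAGE AT BASE TIME `0` (B-TWP0c).**  See the module docstring; hypotheses = those of `curved_web_package`. -/
theorem curved_time_web_package {C : ℝ} {U : ℝ → EuclideanSpace ℝ (Fin 3) → EuclideanSpace ℝ (Fin 3)} {Γ νΓ : ℝ → EuclideanSpace ℝ (Fin 3)} {R μ : ℝ → ℝ → ℝ}
    {σ κ r δ ρ : ℝ}
    (hUrate : HasTypeITimeDecay C U) (hUcont : ContinuousOn (uncurry U) (Iio (0 : ℝ) ×ˢ univ))
    (hUmild : ∀ s t : ℝ, s < t → t < 0 → ∀ x, U t x = heatExtension (U s) (t - s) x - oseenDuhamel 1 s U U t x)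
    (hUdiv : ∀ t < 0, VectorCalculus.IsDivFree (U t))
    (hUpol : ∀ s < 0, ∀ q, ⟪curl (U s) q, EuclideanSpace.single 2 1⟫_ℝ = 0)
    (hUne : U (-1) 0 2 ≠ 0) (hUhotbd : ∀ t < 0, ∀ x, Real.sqrt (-t) * |U t x 2| ≤ |U (-1) 0 2|)
    (hUcrit : ∀ y ∈ {y : EuclideanSpace ℝ (Fin 3) | y 2 = 0 ∧ U (-1) y 2 = U (-1) 0 2}, fderiv ℝ (fun x => U (-1) x 2) y = 0)
    (hσ : σ = 1 ∨ σ = -1) (hσN : σ * U (-1) 0 2 = |U (-1) 0 2|) (hκ : 0 < κ)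
    (hΓ : ContDiff ℝ ∞ Γ) (hΓ2 : ∀ s, Γ s 2 = 0) (hΓunit : ∀ s, ‖deriv Γ s‖ = 1) (hΓhot : ∀ s, U (-1) (Γ s) 2 = U (-1) 0 2)
    (hν : ∀ s, νΓ s = WithLp.toLp 2 ![-(deriv Γ s 1), deriv Γ s 0, 0])
    (hΓcurv : ∀ s, κ ≤ -(fderiv ℝ (fderiv ℝ (fun y => σ * U (-1) y 2)) (Γ s) (νΓ s) (νΓ s)))
    (hr : 0 < r) (hδ : 0 < δ)
    (hconc : ∀ τ z : ℝ, |τ| < δ → |z| < δ → ∀ s : ℝ, ∀ n ∈ Ioo (-r) r,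
      fderiv ℝ (fderiv ℝ (fun y => σ * U (-1 + τ) y 2)) (Γ s + n • νΓ s + z • EuclideanSpace.single 2 (1 : ℝ)) (νΓ s) (νΓ s) < 0)
    (hweb : ∀ τ₀ z₀ : ℝ, |τ₀| < δ → |z₀| < δ → ∀ s₀ : ℝ, ∃ n₀ ∈ Ioo (-r) r,
      σ * U (-1 + τ₀) (Γ s₀ + n₀ • νΓ s₀ + z₀ • EuclideanSpace.single 2 (1 : ℝ)) 2 = R τ₀ z₀ ∧
      (∀ n ∈ Icc (-r) r, n ≠ n₀ → σ * U (-1 + τ₀) (Γ s₀ + n • νΓ s₀ + z₀ • EuclideanSpace.single 2 (1 : ℝ)) 2 < R τ₀ z₀) ∧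
      DifferentiableAt ℝ (uncurry R) (τ₀, z₀) ∧
      fderiv ℝ (uncurry fun τ y => σ * U (-1 + τ) y 2) (τ₀, Γ s₀ + n₀ • νΓ s₀ + z₀ • EuclideanSpace.single 2 (1 : ℝ)) =
        (fderiv ℝ (uncurry R) (τ₀, z₀)).comp
          ((ContinuousLinearMap.fst ℝ ℝ (EuclideanSpace ℝ (Fin 3))).prod
            ((EuclideanSpace.proj (2 : Fin 3)).comp (ContinuousLinearMap.snd ℝ ℝ (EuclideanSpace ℝ (Fin 3))))))
    (hρ : 0 < ρ) (hμ3 : ContDiff ℝ 3 (uncurry μ))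
    (hslabU : ∀ t : ℝ, |t + 1| < ρ → ∀ x : EuclideanSpace ℝ (Fin 3), |x 2| < ρ → ∀ b : Fin 3, b ≠ 2 →
      fderiv ℝ (U t) x (EuclideanSpace.single 2 1) b = μ t (x 2) * fderiv ℝ (U t) x (EuclideanSpace.single b 1) 2)
    (hevU : ∀ t₀ : ℝ, |t₀ + 1| < ρ → ∀ y₀ : EuclideanSpace ℝ (Fin 3), y₀ 2 = 0 →
      ∀ᶠ z in 𝓝 ((t₀, y₀) : ℝ × EuclideanSpace ℝ (Fin 3)), ∀ b : Fin 3, b ≠ 2 →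
        fderiv ℝ (U z.1) z.2 (EuclideanSpace.single 2 1) b = μ z.1 (z.2 2) * fderiv ℝ (U z.1) z.2 (EuclideanSpace.single b 1) 2) :
    ∃ (δ' : ℝ) (n₀ : ℝ × ℝ × ℝ → ℝ) (κt : ℝ → ℝ → ℝ) (k d : ℝ → ℝ) (K : ℝ), 0 < δ' ∧ δ' ≤ δ ∧ δ' ≤ ρ ∧ δ' < 1 / 2 ∧
      -- the branch: Frenet law with differentiable bounded curvature
      (∀ s, deriv (deriv Γ) s = k s • rotJ (deriv Γ s)) ∧ Differentiable ℝ k ∧ (∀ s, |k s| ≤ K) ∧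
      -- the parallel offset at `τ = 0`
      d 0 = 0 ∧ (∀ z : ℝ, |z| < δ' → ContDiffAt ℝ ∞ d z) ∧ (∀ z : ℝ, |z| < δ' → ∀ s, |k s * d z| ≤ 1 / 2) ∧
      -- the space–time web function in `Γ`'s Fermi frame and the identities at its web points
      (∀ q : ℝ × ℝ × ℝ, |q.1| < δ' → |q.2.2| < δ' →
        n₀ q ∈ Ioo (-r) r ∧
        σ * U (-1 + q.1) (Γ q.2.1 + n₀ q • rotJ (deriv Γ q.2.1) + q.2.2 • e2) 2 = R q.1 q.2.2 ∧
        (∀ n ∈ Icc (-r) r, n ≠ n₀ q → σ * U (-1 + q.1) (Γ q.2.1 + n • rotJ (deriv Γ q.2.1) + q.2.2 • e2) 2 < R q.1 q.2.2) ∧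
        (∀ w : EuclideanSpace ℝ (Fin 3), w 2 = 0 → fderiv ℝ (fun y => U (-1 + q.1) y 2) (Γ q.2.1 + n₀ q • rotJ (deriv Γ q.2.1) + q.2.2 • e2) w = 0) ∧
        (∀ m : ℕ∞, ContDiffAt ℝ m n₀ q) ∧
        0 < κt q.1 q.2.2 ∧ μ (-1 + q.1) q.2.2 < 1 ∧
        fderiv ℝ (fderiv ℝ (fun y => σ * U (-1 + q.1) y 2)) (Γ q.2.1 + n₀ q • rotJ (deriv Γ q.2.1) + q.2.2 • e2) (deriv Γ q.2.1) (deriv Γ q.2.1) +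
            fderiv ℝ (fderiv ℝ (fun y => σ * U (-1 + q.1) y 2)) (Γ q.2.1 + n₀ q • rotJ (deriv Γ q.2.1) + q.2.2 • e2)
              (rotJ (deriv Γ q.2.1)) (rotJ (deriv Γ q.2.1)) = -κt q.1 q.2.2 ∧
        fderiv ℝ (fderiv ℝ (fun y => σ * U (-1 + q.1) y 2)) (Γ q.2.1 + n₀ q • rotJ (deriv Γ q.2.1) + q.2.2 • e2) e2 e2 =
          -μ (-1 + q.1) q.2.2 *
            (fderiv ℝ (fderiv ℝ (fun y => σ * U (-1 + q.1) y 2)) (Γ q.2.1 + n₀ q • rotJ (deriv Γ q.2.1) + q.2.2 • e2) (deriv Γ q.2.1) (deriv Γ q.2.1) +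
              fderiv ℝ (fderiv ℝ (fun y => σ * U (-1 + q.1) y 2)) (Γ q.2.1 + n₀ q • rotJ (deriv Γ q.2.1) + q.2.2 • e2)
                (rotJ (deriv Γ q.2.1)) (rotJ (deriv Γ q.2.1))) ∧
        κt q.1 q.2.2 * (1 - k q.2.1 * n₀ q) ^ 2 * (fderiv ℝ n₀ q ((0 : ℝ), (0 : ℝ), (1 : ℝ))) ^ 2 =
          (deriv (deriv (R q.1)) q.2.2 - μ (-1 + q.1) q.2.2 * κt q.1 q.2.2) *
            ((1 - k q.2.1 * n₀ q) ^ 2 + (fderiv ℝ n₀ q ((0 : ℝ), (1 : ℝ), (0 : ℝ))) ^ 2)) ∧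
      -- parallel webs at `τ = 0`
      (∀ s z : ℝ, |z| < δ' → n₀ ((0 : ℝ), s, z) = d z) := by
  have hm1 : (-1 : ℝ) < 0 := by norm_num
  /- STEP 1: the branch, its frame, the parallel-web package at `τ = 0`. -/
  have hΓc2 : ContDiff ℝ 2 Γ := hΓ.of_le (by norm_cast)
  have hT2 : ∀ s, deriv Γ s 2 = 0 := fun s => (deriv_horizontal hΓc2 hΓ2 s).1
  have hTunit : ∀ s, deriv Γ s 0 ^ 2 + deriv Γ s 1 ^ 2 = 1 := fun s => sq_add_sq_of_horizontal_unit (hT2 s) (hΓunit s)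
  have hνJ : ∀ s, νΓ s = rotJ (deriv Γ s) := fun s => by rw [hν s]; rfl
  have hJv : ∀ s, Jvec (deriv Γ s) = rotJ (deriv Γ s) := fun s => rfl
  have hpt : ∀ s n z : ℝ, Γ s + n • νΓ s + z • EuclideanSpace.single 2 (1 : ℝ) = Γ s + n • rotJ (deriv Γ s) + z • e2 := fun s n z => by
    rw [hνJ s]; rfl
  set W : ℝ × ℝ × ℝ → ℝ → EuclideanSpace ℝ (Fin 3) := fun q n => Γ q.2.1 + n • rotJ (deriv Γ q.2.1) + q.2.2 • e2 with hW
  have hW2 : ∀ q n, W q n 2 = q.2.2 := fun q n => by simp [hW, hΓ2, rotJ, e2]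
  obtain ⟨δ₂, d, κf, k, K, hδ₂, hδ₂δ, hδ₂ρ, hk, hkd, hkK, hd0, hdCD, hdwin, -, -, hκf0, hwin, -, hpar, -, -, hridge0, -⟩ :=
    curved_web_package hUrate hUcont hUmild hUdiv hUpol hUne hUhotbd hUcrit hσ hσN hκ hΓ hΓ2 hΓunit hΓhot hν hΓcurv hr hδ hconc hweb hρ hμ3
      hslabU hevU
  /- STEP 2: the space–time function and the space–time web function over `Γ`. -/
  set T : Set ℝ := Ioo (-1 / 2 : ℝ) (1 / 2) with hT_def; have hTo : IsOpen T := isOpen_Ioo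
  obtain ⟨F, hF_def⟩ : ∃ F : ℝ → EuclideanSpace ℝ (Fin 3) → ℝ, F = fun τ y => σ * U (-1 + τ) y 2 := ⟨_, rfl⟩
  have hFst : IsSmoothSpaceTimeOn T F := by
    have h := contDiffOn_uncurry_signed hUrate hUcont hUmild hUdiv σ (n := ⊤) (T := T) Subset.rfl
    rw [hF_def]; exact h
  have hTabs : ∀ τ : ℝ, |τ| < 1 / 2 → τ ∈ T := fun τ hτ => ⟨by linarith [(abs_lt.1 hτ).1], (abs_lt.1 hτ).2⟩
  set δ₀ : ℝ := min δ₂ (1 / 4) with hδ₀_def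
  have hδ₀ : 0 < δ₀ := lt_min hδ₂ (by norm_num); have hδ₀h : δ₀ < 1 / 2 := lt_of_le_of_lt (min_le_right _ _) (by norm_num)
  have hδ₀δ₂ : δ₀ ≤ δ₂ := min_le_left _ _
  have hδ₀δ : δ₀ ≤ δ := hδ₀δ₂.trans hδ₂δ; have hδ₀ρ : δ₀ ≤ ρ := hδ₀δ₂.trans hδ₂ρ
  have hδ₀T : Ioo (-δ₀) δ₀ ⊆ T := fun τ hτ => ⟨by linarith [hτ.1], by linarith [hτ.2]⟩
  have hconcF : ∀ τ z : ℝ, |τ| < δ₀ → |z| < δ₀ → ∀ s : ℝ, ∀ n ∈ Ioo (-r) r,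
      fderiv ℝ (fderiv ℝ (F τ)) (Γ s + n • rotJ (deriv Γ s) + z • e2) (rotJ (deriv Γ s)) (rotJ (deriv Γ s)) < 0 := by
    intro τ z hτ hz s n hn
    have h := hconc τ z (lt_of_lt_of_le hτ hδ₀δ) (lt_of_lt_of_le hz hδ₀δ) s n hn
    rw [hpt, hνJ] at h
    rw [hF_def]; exact h
  have hS : ∀ τ z : ℝ, |τ| < δ₀ → |z| < δ₀ → ∀ s : ℝ, ∃ n₁ ∈ Ioo (-r) r, F τ (Γ s + n₁ • rotJ (deriv Γ s) + z • e2) = R τ z ∧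
      ∀ n ∈ Icc (-r) r, n ≠ n₁ → F τ (Γ s + n • rotJ (deriv Γ s) + z • e2) < R τ z := by
    intro τ z hτ hz s
    obtain ⟨n₁, hn₁, hval, huniq, -, -⟩ := hweb τ z (lt_of_lt_of_le hτ hδ₀δ) (lt_of_lt_of_le hz hδ₀δ) s
    refine ⟨n₁, hn₁, ?_, fun n hn hne => ?_⟩
    · rw [hF_def, ← hpt]; exact hval
    · rw [hF_def, ← hpt]; exact huniq n hn hne
  obtain ⟨n₀, hspec, hcritν, hCm⟩ := exists_curvedTimeWebFunction hTo hFst hΓ hδ₀T hconcF hS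
  have hAweb : ∀ q : ℝ × ℝ × ℝ, |q.1| < δ₀ → |q.2.2| < δ₀ →
      fderiv ℝ (uncurry fun τ y => σ * U (-1 + τ) y 2) (q.1, W q (n₀ q)) =
        (fderiv ℝ (uncurry R) (q.1, q.2.2)).comp ((ContinuousLinearMap.fst ℝ ℝ (EuclideanSpace ℝ (Fin 3))).prod
          ((EuclideanSpace.proj (2 : Fin 3)).comp (ContinuousLinearMap.snd ℝ ℝ (EuclideanSpace ℝ (Fin 3))))) := by
    intro q h1 h2
    obtain ⟨n₁, hn₁, hval₁, -, -, hfd⟩ := hweb q.1 q.2.2 (lt_of_lt_of_le h1 hδ₀δ) (lt_of_lt_of_le h2 hδ₀δ) q.2.1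
    have hn : n₁ = n₀ q := by
      by_contra hne
      have hlt := (hspec q h1 h2).2.2 n₁ (Ioo_subset_Icc_self hn₁) hne
      rw [hpt] at hval₁
      rw [hF_def] at hlt
      exact absurd hval₁ hlt.ne
    rw [hpt, hn] at hfd
    exact hfd
  have hhoriz : ∀ q : ℝ × ℝ × ℝ, |q.1| < δ₀ → |q.2.2| < δ₀ → ∀ w : EuclideanSpace ℝ (Fin 3), w 2 = 0 →
      fderiv ℝ (fun y => U (-1 + q.1) y 2) (W q (n₀ q)) w = 0 := by
    intro q h1 h2 w hw
    have hτ : |q.1| < 1 / 2 := lt_trans h1 hδ₀h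
    have h := webData_of_fderiv_uncurry hUrate hUcont hUmild hUdiv hσ hτ (hAweb q h1 h2) (hAweb q h1 h2) rfl
    have ht : -1 + q.1 < 0 := by linarith [(abs_lt.1 hτ).2]
    have hU1 : ContDiff ℝ 1 (U (-1 + q.1)) := contDiff_slice_of_class hUrate hUcont hUmild hUdiv ht
    have hUd : Differentiable ℝ (U (-1 + q.1)) := hU1.differentiable one_ne_zero
    exact fderiv_two_horizontal_eq_zero (hUd _) h.2.2.2.1 h.2.2.2.2.1 hw
  have hFτ_def : ∀ τ, F τ = fun y => σ * U (-1 + τ) y 2 := fun τ => by rw [hF_def]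
  have hθ2τ : ∀ τ : ℝ, |τ| < 1 / 2 → ContDiff ℝ 2 (fun y => U (-1 + τ) y 2) := fun τ hτ => contDiff_two_vert_at hUrate hUcont hUmild hUdiv hτ
  have hF3τ : ∀ τ : ℝ, |τ| < 1 / 2 → ContDiff ℝ 3 (F τ) := fun τ hτ =>
    (hFst.contDiff_slice (hTabs τ hτ)).of_le (by exact WithTop.coe_le_coe.2 le_top)
  have hframe : ∀ τ : ℝ, |τ| < 1 / 2 → ∀ s : ℝ, ∀ x : EuclideanSpace ℝ (Fin 3),
      fderiv ℝ (fderiv ℝ (F τ)) x (deriv Γ s) (deriv Γ s) + fderiv ℝ (fderiv ℝ (F τ)) x (rotJ (deriv Γ s)) (rotJ (deriv Γ s)) =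
        σ * (fderiv ℝ (fun w => fderiv ℝ (fun y => U (-1 + τ) y 2) w (EuclideanSpace.single 0 (1 : ℝ))) x (EuclideanSpace.single 0 (1 : ℝ)) +
          fderiv ℝ (fun w => fderiv ℝ (fun y => U (-1 + τ) y 2) w (EuclideanSpace.single 1 (1 : ℝ))) x (EuclideanSpace.single 1 (1 : ℝ))) := by
    intro τ hτ s x; rw [hFτ_def, ← hJv]; exact frame_trace_at hUrate hUcont hUmild hUdiv (hT2 s) (hTunit s) hτ x
  have hslice₀ : ∀ τ : ℝ, |τ| < 1 / 2 → |τ| < ρ → ∀ s : ℝ, ∀ x : EuclideanSpace ℝ (Fin 3), |x 2| < ρ →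
      fderiv ℝ (fderiv ℝ (F τ)) x e2 e2 =
        -μ (-1 + τ) (x 2) * (fderiv ℝ (fderiv ℝ (F τ)) x (deriv Γ s) (deriv Γ s) + fderiv ℝ (fderiv ℝ (F τ)) x (rotJ (deriv Γ s)) (rotJ (deriv Γ s))) := by
    intro τ hτ hτρ s x hx; rw [hFτ_def, ← hJv]; exact slice_law_at hUrate hUcont hUmild hUdiv (hT2 s) (hTunit s) hτ hτρ hslabU hx
  obtain ⟨κt, hκt_def⟩ : ∃ κt : ℝ → ℝ → ℝ, κt = fun τ z => -(fderiv ℝ (fderiv ℝ (F τ)) (W (τ, 0, z) (n₀ (τ, 0, z))) (deriv Γ 0) (deriv Γ 0) +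
      fderiv ℝ (fderiv ℝ (F τ)) (W (τ, 0, z) (n₀ (τ, 0, z))) (rotJ (deriv Γ 0)) (rotJ (deriv Γ 0))) := ⟨_, rfl⟩
  /- STEP 3: parallel webs at `τ = 0` by uniqueness of the maximiser; `κt(0,0) = κf(0) ≥ κ`. -/
  have habsI : ∀ {a : ℝ} {z : ℝ}, z ∈ Ioo (-a) a ↔ |z| < a := fun {a z} => by rw [mem_Ioo, abs_lt]
  have hpar0 : ∀ s z : ℝ, |z| < δ₀ → n₀ ((0 : ℝ), s, z) = d z := by
    intro s z hz
    have hz₂ : z ∈ Ioo (-δ₂) δ₂ := habsI.2 (lt_of_lt_of_le hz hδ₀δ₂)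
    obtain ⟨hvd, huniqd⟩ := hpar s z hz₂
    obtain ⟨hin, -, -⟩ := hspec ((0 : ℝ), s, z) (by simpa using hδ₀) (by simpa using hz)
    by_contra hne
    have hlt := huniqd (n₀ ((0 : ℝ), s, z)) (Ioo_subset_Icc_self hin) hne
    have hval := (hspec ((0 : ℝ), s, z) (by simpa using hδ₀) (by simpa using hz)).2.1
    rw [hF_def] at hval; simp only [add_zero] at hval
    exact absurd hval hlt.ne
  have hn00 : ∀ s : ℝ, n₀ ((0 : ℝ), s, (0 : ℝ)) = 0 := fun s => by rw [hpar0 s 0 (by simpa using hδ₀), hd0]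
  have hκ00 : κ ≤ κt 0 0 := by
    have h0mem : (0 : ℝ) ∈ Ioo (-δ₂) δ₂ := ⟨by linarith, hδ₂⟩
    have hr0 := hridge0 0 0 h0mem
    rw [hd0] at hr0
    have hpt0 : W ((0 : ℝ), (0 : ℝ), (0 : ℝ)) (n₀ ((0 : ℝ), (0 : ℝ), (0 : ℝ))) = Γ 0 + (0 : ℝ) • rotJ (deriv Γ 0) + (0 : ℝ) • e2 := by
      rw [hn00 0]
    rw [hκt_def]; simp only
    rw [hpt0, hFτ_def 0]; simp only [add_zero]
    linarith [(hwin 0 h0mem).2.2.1, hr0]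
  /- STEP 4: continuity of `κt` and `μ` at `(0,0)`; the window `δ′`. -/
  have hn₀c : ContinuousAt (fun w : ℝ × ℝ => n₀ (w.1, 0, w.2)) ((0 : ℝ), (0 : ℝ)) := by
    have h1 : ContDiffAt ℝ 1 n₀ ((0 : ℝ), (0 : ℝ), (0 : ℝ)) := hCm 1 _ (by simpa using hδ₀) (by simpa using hδ₀)
    have h2 : ContinuousAt (fun w : ℝ × ℝ => ((w.1, (0 : ℝ), w.2) : ℝ × ℝ × ℝ)) ((0 : ℝ), (0 : ℝ)) :=
      (continuous_fst.prodMk (continuous_const.prodMk continuous_snd)).continuousAt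
    exact h1.continuousAt.comp_of_eq h2 rfl
  have hgc : ContinuousAt (fun w : ℝ × ℝ => W (w.1, 0, w.2) (n₀ (w.1, 0, w.2))) ((0 : ℝ), (0 : ℝ)) := by
    simp only [hW]
    exact (continuousAt_const.add (hn₀c.smul continuousAt_const)).add (continuousAt_snd.smul continuousAt_const)
  have hκc : ContinuousAt (fun w : ℝ × ℝ => κt w.1 w.2) ((0 : ℝ), (0 : ℝ)) := by
    have h := ((continuousAt_sliceHessian hTo hFst (w₀ := ((0 : ℝ), (0 : ℝ))) (hTabs 0 (by norm_num)) hgc (deriv Γ 0) (deriv Γ 0)).add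
      (continuousAt_sliceHessian hTo hFst (w₀ := ((0 : ℝ), (0 : ℝ))) (hTabs 0 (by norm_num)) hgc (rotJ (deriv Γ 0)) (rotJ (deriv Γ 0)))).neg
    rw [hκt_def]; exact h
  have hμc : ContinuousAt (fun w : ℝ × ℝ => μ (-1 + w.1) w.2) ((0 : ℝ), (0 : ℝ)) := by
    have h : ContinuousAt (fun w : ℝ × ℝ => ((-1 + w.1, w.2) : ℝ × ℝ)) ((0 : ℝ), (0 : ℝ)) :=
      ((continuous_const.add continuous_fst).prodMk continuous_snd).continuousAt
    exact hμ3.continuous.continuousAt.comp_of_eq h rfl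
  have hμ01 : μ (-1) 0 < 1 := (hwin 0 ⟨by linarith, hδ₂⟩).2.2.2
  obtain ⟨ε, hε, hball⟩ : ∃ ε > 0, ∀ w : ℝ × ℝ, |w.1| < ε → |w.2| < ε → 0 < κt w.1 w.2 ∧ μ (-1 + w.1) w.2 < 1 := by
    have h1 : ∀ᶠ w : ℝ × ℝ in 𝓝 ((0 : ℝ), (0 : ℝ)), 0 < κt w.1 w.2 := hκc.eventually_const_lt (lt_of_lt_of_le hκ hκ00)
    have h2 : ∀ᶠ w : ℝ × ℝ in 𝓝 ((0 : ℝ), (0 : ℝ)), μ (-1 + w.1) w.2 < 1 := hμc.eventually_lt_const (by simp only [add_zero]; exact hμ01)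
    obtain ⟨ε, hε, h⟩ := Metric.eventually_nhds_iff.1 (h1.and h2)
    refine ⟨ε, hε, fun w hw1 hw2 => h ?_⟩
    rw [Prod.dist_eq]; simp only [Real.dist_eq, sub_zero]; exact max_lt hw1 hw2
  set δ' : ℝ := min δ₀ ε with hδ'_def
  have hδ' : 0 < δ' := lt_min hδ₀ hε; have hδ'δ₀ : δ' ≤ δ₀ := min_le_left _ _; have hδ'ε : δ' ≤ ε := min_le_right _ _
  have hI : ∀ q : ℝ × ℝ × ℝ, |q.1| < δ' → |q.2.2| < δ' →
      |q.1| < δ₀ ∧ |q.2.2| < δ₀ ∧ |q.1| < 1 / 2 ∧ |q.1| < ρ ∧ |q.2.2| < ρ ∧ 0 < κt q.1 q.2.2 ∧ μ (-1 + q.1) q.2.2 < 1 := by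
    intro q h1 h2
    have h1' := lt_of_lt_of_le h1 hδ'δ₀
    have h2' := lt_of_lt_of_le h2 hδ'δ₀
    exact ⟨h1', h2', lt_trans h1' hδ₀h, lt_of_lt_of_le h1' hδ₀ρ, lt_of_lt_of_le h2' hδ₀ρ,
      (hball (q.1, q.2.2) (lt_of_lt_of_le h1 hδ'ε) (lt_of_lt_of_le h2 hδ'ε)).1,
      (hball (q.1, q.2.2) (lt_of_lt_of_le h1 hδ'ε) (lt_of_lt_of_le h2 hδ'ε)).2⟩
  /- STEP 5: the ridge law at every nearby time (s-free) and the slice law at the web points. -/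
  have hridge : ∀ q : ℝ × ℝ × ℝ, |q.1| < δ' → |q.2.2| < δ' →
      fderiv ℝ (fderiv ℝ (F q.1)) (W q (n₀ q)) (deriv Γ q.2.1) (deriv Γ q.2.1) +
        fderiv ℝ (fderiv ℝ (F q.1)) (W q (n₀ q)) (rotJ (deriv Γ q.2.1)) (rotJ (deriv Γ q.2.1)) = -κt q.1 q.2.2 := by
    intro q h1 h2
    obtain ⟨h1₀, h2₀, hτh, hτρ, hzρ, -, hμ1⟩ := hI q h1 h2
    set y := W q (n₀ q) with hy
    set y' := W (q.1, 0, q.2.2) (n₀ (q.1, 0, q.2.2)) with hy'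
    have hyy' : y 2 = y' 2 := by rw [hy, hy', hW2, hW2]
    have hO : IsOpen ({w : ℝ × EuclideanSpace ℝ (Fin 3) | |w.1 + 1| < ρ} ∩ {w | |w.2 2| < ρ}) :=
      (isOpen_lt (continuous_abs.comp (continuous_fst.add continuous_const)) continuous_const).inter
        (isOpen_lt (continuous_abs.comp ((EuclideanSpace.proj (𝕜 := ℝ) (2 : Fin 3)).continuous.comp continuous_snd)) continuous_const)
    have hslopeEv : ∀ w : EuclideanSpace ℝ (Fin 3), w 2 = y 2 →
        ∀ᶠ v in 𝓝 ((-1 + q.1, w) : ℝ × EuclideanSpace ℝ (Fin 3)), ∀ b : Fin 3, b ≠ 2 →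
          fderiv ℝ (U v.1) v.2 (EuclideanSpace.single 2 1) b = μ v.1 (v.2 2) * fderiv ℝ (U v.1) v.2 (EuclideanSpace.single b 1) 2 := by
      intro w hw
      have hmem : ((-1 + q.1 : ℝ), w) ∈ ({w : ℝ × EuclideanSpace ℝ (Fin 3) | |w.1 + 1| < ρ} ∩ {w | |w.2 2| < ρ}) := by
        refine ⟨by simpa using hτρ, ?_⟩
        show |w 2| < ρ
        rw [hw, hy, hW2]; exact hzρ
      exact Filter.eventually_of_mem (hO.mem_nhds hmem) fun v hv => hslabU v.1 hv.1 v.2 hv.2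
    have hplane' : ∀ w : EuclideanSpace ℝ (Fin 3), w 2 = y 2 → ∀ b : Fin 3, b ≠ 2 →
        fderiv ℝ (U (-1 + q.1)) w (EuclideanSpace.single 2 1) b = μ (-1 + q.1) (y 2) * fderiv ℝ (U (-1 + q.1)) w (EuclideanSpace.single b 1) 2 := by
      intro w hw b hb
      rw [hy, hW2]
      have h := hslabU (-1 + q.1) (by simpa using hτρ) w (by rw [hw, hy, hW2]; exact hzρ) b hb
      rw [hw, hy, hW2] at h; exact h
    have hμ1' : μ (-1 + q.1) (y 2) ≠ 1 := by rw [hy, hW2]; exact hμ1.ne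
    have hvalEq : σ * U (-1 + q.1) y 2 = σ * U (-1 + q.1) y' 2 := by
      have ha := (hspec q h1₀ h2₀).2.1
      have hb := (hspec (q.1, 0, q.2.2) h1₀ h2₀).2.1
      rw [hFτ_def] at ha hb
      simp only at ha hb
      rw [hy, hy', ha, hb]
    have hA := hAweb q h1₀ h2₀
    have hA' := hAweb (q.1, 0, q.2.2) h1₀ h2₀
    have h := horizLaplacian_two_eq_of_webFermat hUrate hUcont hUmild hUdiv hUpol hμ3 hτh hyy' hslopeEv hplane' hμ1' hσ hA hA' hvalEq
    rw [hκt_def]; simp only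
    rw [hframe q.1 hτh q.2.1, hframe q.1 hτh 0, h, neg_neg]
  have hslice : ∀ q : ℝ × ℝ × ℝ, |q.1| < δ' → |q.2.2| < δ' → ∀ n : ℝ,
      fderiv ℝ (fderiv ℝ (F q.1)) (W q n) e2 e2 =
        -μ (-1 + q.1) q.2.2 * (fderiv ℝ (fderiv ℝ (F q.1)) (W q n) (deriv Γ q.2.1) (deriv Γ q.2.1) +
          fderiv ℝ (fderiv ℝ (F q.1)) (W q n) (rotJ (deriv Γ q.2.1)) (rotJ (deriv Γ q.2.1))) := by
    intro q h1 h2 n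
    obtain ⟨-, -, hτh, hτρ, hzρ, -, -⟩ := hI q h1 h2
    have h := hslice₀ q.1 hτh hτρ q.2.1 (W q n) (by rw [hW2]; exact hzρ)
    rw [hW2] at h; exact h
  /- STEP 6: regularity of the slice web function and of `R τ` on the window. -/
  have hGτd : ∀ q : ℝ × ℝ × ℝ, |q.1| < δ' → |q.2.2| < δ' →
      HasFDerivAt (fun p : ℝ × ℝ => n₀ (q.1, p)) ((fderiv ℝ n₀ q).comp (ContinuousLinearMap.inr ℝ ℝ (ℝ × ℝ))) q.2 := by
    intro q h1 h2
    obtain ⟨h1₀, h2₀, -⟩ := hI q h1 h2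
    have hd : DifferentiableAt ℝ n₀ (q.1, q.2) := (hCm 1 q h1₀ h2₀).differentiableAt (by simp)
    exact hd.hasFDerivAt.comp q.2 (hasFDerivAt_sliceIncl q.1 q.2)
  have hRω : ∀ τ z : ℝ, |τ| < δ' → |z| < δ' → ContDiffAt ℝ 3 (R τ) z := by
    intro τ z hτ hz
    obtain ⟨hτ₀, hz₀, hτh, -⟩ := hI (τ, 0, z) hτ hz
    have hWz : ContDiffAt ℝ 3 (fun z' : ℝ => W (τ, 0, z') (n₀ (τ, 0, z'))) z := by
      have h1 : ContDiffAt ℝ 3 (fun z' : ℝ => n₀ (τ, 0, z')) z :=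
        (hCm 3 (τ, 0, z) hτ₀ hz₀).comp z (contDiffAt_const.prodMk (contDiffAt_const.prodMk contDiffAt_id))
      simp only [hW]
      exact (contDiffAt_const.add (h1.smul contDiffAt_const)).add (contDiffAt_id.smul contDiffAt_const)
    refine (((hF3τ τ hτh).contDiffAt).comp z hWz).congr_of_eventuallyEq ?_
    filter_upwards [(isOpen_lt continuous_abs continuous_const).mem_nhds (hz₀ : z ∈ {z' : ℝ | |z'| < δ₀})] with z' hz'
    rw [Function.comp_apply]; exact ((hspec (τ, 0, z') hτ₀ hz').2.1).symm
  have hRon : ∀ τ : ℝ, |τ| < δ' → ContDiffOn ℝ 3 (R τ) (Ioo (-δ') δ') := fun τ hτ z hz => (hRω τ z hτ (habsI.1 hz)).contDiffWithinAt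
  have hR1on : ∀ τ : ℝ, |τ| < δ' → ContDiffOn ℝ 2 (deriv (R τ)) (Ioo (-δ') δ') := fun τ hτ =>
    ((contDiffOn_succ_iff_deriv_of_isOpen isOpen_Ioo).1 (hRon τ hτ)).2.2
  have hRd : ∀ τ : ℝ, |τ| < δ' → ∀ z ∈ Ioo (-δ') δ', DifferentiableAt ℝ (R τ) z := fun τ hτ z hz =>
    (hRω τ z hτ (habsI.1 hz)).differentiableAt (by simp)
  have hR'd : ∀ τ : ℝ, |τ| < δ' → ∀ z ∈ Ioo (-δ') δ', DifferentiableAt ℝ (deriv (R τ)) z := fun τ hτ z hz =>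
    (((hR1on τ hτ).differentiableOn (by norm_num)) z hz).differentiableAt (isOpen_Ioo.mem_nhds hz)
  /- STEP 7: the FERMI HUYGENS FAMILY (this seat's `curved_huygens_identity`, region version). -/
  have hHuy : ∀ q : ℝ × ℝ × ℝ, |q.1| < δ' → |q.2.2| < δ' →
      κt q.1 q.2.2 * (1 - k q.2.1 * n₀ q) ^ 2 * (fderiv ℝ n₀ q ((0 : ℝ), (0 : ℝ), (1 : ℝ))) ^ 2 =
        (deriv (deriv (R q.1)) q.2.2 - μ (-1 + q.1) q.2.2 * κt q.1 q.2.2) *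
          ((1 - k q.2.1 * n₀ q) ^ 2 + (fderiv ℝ n₀ q ((0 : ℝ), (1 : ℝ), (0 : ℝ))) ^ 2) := by
    intro q h1 h2
    obtain ⟨h1₀, -, hτh, -⟩ := hI q h1 h2
    set Gτ : ℝ × ℝ → ℝ := fun p => n₀ (q.1, p) with hGτ
    have hmemI : ∀ p ∈ region (Ioo (-δ') δ'), |((q.1, p) : ℝ × ℝ × ℝ).2.2| < δ' := fun p hp => habsI.1 hp
    have hGd' : ∀ p ∈ region (Ioo (-δ') δ'), DifferentiableAt ℝ Gτ p := fun p hp =>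
      (hGτd (q.1, p) h1 (hmemI p hp)).differentiableAt
    have hWeq : ∀ p : ℝ × ℝ, Γ p.1 + Gτ p • rotJ (deriv Γ p.1) + p.2 • e2 = W (q.1, p) (n₀ (q.1, p)) := fun p => rfl
    have hH := curved_huygens_identity (hF3τ q.1 hτh) hΓc2 hΓ2 hk isOpen_Ioo hGd'
      (R := R q.1) (κ := κt q.1) (μ := μ (-1 + q.1))
      (fun z hz => (hR'd q.1 h1 z hz).hasDerivAt) (fun z hz => hRd q.1 h1 z hz)
      (fun p hp => by rw [hWeq]; exact hcritν (q.1, p) h1₀ (hI (q.1, p) h1 (hmemI p hp)).2.1)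
      (fun p hp => by
        have hh := hhoriz (q.1, p) h1₀ (hI (q.1, p) h1 (hmemI p hp)).2.1 (deriv Γ p.1) (hT2 p.1)
        rw [hWeq, hFτ_def, fderiv_const_mul (((hθ2τ q.1 hτh).differentiable (by norm_num)) _)]
        simp [hh])
      (fun p hp => by rw [hWeq]; exact (hspec (q.1, p) h1₀ (hI (q.1, p) h1 (hmemI p hp)).2.1).2.1)
      (fun p hp => by rw [hWeq]; exact hridge (q.1, p) h1 (hmemI p hp))
      (fun p hp => by rw [hWeq]; exact hslice (q.1, p) h1 (hmemI p hp) _)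
      (p := q.2) (habsI.2 h2)
    have hGz : fderiv ℝ Gτ q.2 (0, 1) = fderiv ℝ n₀ q ((0 : ℝ), (0 : ℝ), (1 : ℝ)) := by
      rw [(hGτd q h1 h2).fderiv]; simp
    have hGs : fderiv ℝ Gτ q.2 (1, 0) = fderiv ℝ n₀ q ((0 : ℝ), (1 : ℝ), (0 : ℝ)) := by
      rw [(hGτd q h1 h2).fderiv]; simp
    rw [hGz, hGs] at hH
    exact hH
  /- STEP 8: assembly of the output. -/
  refine ⟨δ', n₀, κt, k, d, K, hδ', hδ'δ₀.trans hδ₀δ, hδ'δ₀.trans hδ₀ρ, lt_of_le_of_lt hδ'δ₀ hδ₀h, hk, hkd, hkK, hd0,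
    fun z hz => hdCD z (lt_of_lt_of_le hz (hδ'δ₀.trans hδ₀δ)),
    fun z hz s => ((hdwin z (habsI.2 (lt_of_lt_of_le hz (hδ'δ₀.trans hδ₀δ₂)))).2 s),
    fun q h1 h2 => ?_, fun s z hz => hpar0 s z (lt_of_lt_of_le hz hδ'δ₀)⟩
  obtain ⟨h1₀, h2₀, -, -, -, hκpos, hμ1⟩ := hI q h1 h2
  obtain ⟨hin, hval, huniq⟩ := hspec q h1₀ h2₀
  refine ⟨hin, ?_, fun n hn hne => ?_, hhoriz q h1₀ h2₀, fun m => hCm m q h1₀ h2₀, hκpos, hμ1, ?_, ?_, hHuy q h1 h2⟩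
  · rw [hFτ_def] at hval; exact hval
  · have h := huniq n hn hne; rw [hFτ_def] at h; exact h
  · have h := hridge q h1 h2; rw [hFτ_def] at h; exact h
  · have h := hslice q h1 h2 (n₀ q); rw [hFτ_def] at h; exact h

end Summit.NavierStokesRegularity.NavierStokesRegularity.Theorems.PoloidalWindowDoorLrcModEntireCurvedTimeWebAt

end
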